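import Summits.QuantumAdvantage.QuantumAdvantage.Theorems.MobiusLadderLiouvilleOrthogonalTC0StubLtfCore
import HarnessLib

/-!
# Crux `MobiusLadder.LiouvilleOrthogonalTC0` (stmt-QuantumAdvantage-1393): the spectral criterion —
`λ` is orthogonal to every uniformly noise-stable family of Boolean functions of the digits

Line `Sketch`, skeleton v4 (lead `prover-line-stmt-QuantumAdvantage-1393-c2-0`). The engine behind the
depth-one rung (`stub_ltfCore`), stated once in reusable form: if `τ(m) → 0`, then for every `ε > 0`,
eventually in `n`, EVERY Boolean function `F` of `n` bits whose Fourier tails obey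
`W^{≥ m}[sgn ∘ F] ≤ τ(m)` for all `m ≥ 1` satisfies `|Σ_{N<2ⁿ} λ(N) sgn F(bits N)| ≤ ε 2ⁿ`.

So Möbius randomness holds for every class of digital functions with a UNIFORM (in `n`) Fourier-tail
bound: linear threshold functions (Peres; `stub_peresTail`, giving the depth-one `tcBasis` rung), and
any future class for which such a bound is proved (e.g. polynomial threshold functions of bounded
degree, intersections of boundedly many halfspaces). (`AC⁰` is NOT uniformly noise-stable — Tal's
tail bound degrades with `log size` — and needs Green's balancing of the level against `log size`, the
tree's `LiouvilleOrthogonalAC0_proof`.) Depth-two majority circuits contain functions with no Fourier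
concentration at all, which is exactly where every spectral method — and the line — stops
(`stub_hyp_pos`).

Proof: Green 2012 §2 (`GreenAC0.core_bound`) with the empty and the small characters
(`1 ≤ |S| ≤ k = ⌊n^{1/R}⌋₊`, `R = ⌈3/c⌉₊`) bounded by Bourgain's uniform Möbius–Walsh bound for `λ`
(`bourgain_liouville_walsh_holds`, `2^{n-n^c}`; arithmetic `LtfCore.low_term_le`) and the tail at level
`k + 1` by the hypothesis, `√τ(k+1) ≤ ε/3` eventually because `k → ∞`.
-/

set_option linter.dupNamespace false -- D-0017: single-problem summit ⇒ `QuantumAdvantage.QuantumAdvantage` by design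

noncomputable section

namespace Summit.QuantumAdvantage.QuantumAdvantage.Theorems.LiouvilleOrthogonalTC0

open Filter Finset Topology
open Literature.Computability.Complexity
open Literature.Computability.Complexity.LowDegree (tailWeight)
open Literature.Probability.RandomGraphs.LowDegree (sgn walsh walsh_empty)
open Literature.NumberTheory.Sieve

namespace Spectral

/-- Eventually in `n`, the parameter `k = ⌊n^{1/R}⌋₊` is past `R + 1`, `2^{-k} ≤ ε/3`, and
`τ(k+1) ≤ (ε/3)²`. -/
theorem eventually_params {R : ℕ} (hR : 1 ≤ R) {ε : ℝ} (hε : 0 < ε) {τ : ℕ → ℝ}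
    (hτ : Tendsto τ atTop (𝓝 0)) :
    ∀ᶠ n : ℕ in atTop, R + 1 ≤ ⌊((n : ℝ)) ^ ((1 : ℝ) / R)⌋₊ ∧
      ((2 : ℝ)⁻¹) ^ ⌊((n : ℝ)) ^ ((1 : ℝ) / R)⌋₊ ≤ ε / 3 ∧
      τ (⌊((n : ℝ)) ^ ((1 : ℝ) / R)⌋₊ + 1) ≤ (ε / 3) ^ 2 := by
  have hT := LtfCore.tendsto_floor_rpow hR
  have hε3 : 0 < ε / 3 := by positivity
  have h1 : ∀ᶠ k : ℕ in atTop, R + 1 ≤ k := eventually_ge_atTop _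
  have h2 : ∀ᶠ k : ℕ in atTop, ((2 : ℝ)⁻¹) ^ k ≤ ε / 3 :=
    Filter.Tendsto.eventually_le_const hε3
      (tendsto_pow_atTop_nhds_zero_of_lt_one (by norm_num) (by norm_num))
  have h3 : ∀ᶠ k : ℕ in atTop, τ (k + 1) ≤ (ε / 3) ^ 2 := by
    have h3' : ∀ᶠ m : ℕ in atTop, τ m ≤ (ε / 3) ^ 2 :=
      Filter.Tendsto.eventually_le_const (by positivity) hτ
    exact (tendsto_add_atTop_nat 1).eventually h3'
  exact hT.eventually (h1.and (h2.and h3))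

end Spectral

open Spectral in
/-- **The spectral criterion for Möbius randomness of digital functions.** Let `τ : ℕ → ℝ` with
`τ(m) → 0`. For every `ε > 0`, for all sufficiently large `n`, every Boolean function `F` of `n` bits
with Fourier tails `W^{≥ m}[sgn ∘ F] ≤ τ(m)` for all `m ≥ 1` satisfies
`|Σ_{N<2ⁿ} λ(N) · sgn F(bits N)| ≤ ε · 2ⁿ`. (Bourgain's uniform Möbius–Walsh bound for `λ` + Green's
§2 deduction; the threshold `n₀(ε, τ)` does not depend on `F`.) -/
theorem liouville_orthogonal_of_tailWeight (τ : ℕ → ℝ) (hτ : Tendsto τ atTop (𝓝 0)) :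
    ∀ ε : ℝ, 0 < ε → ∀ᶠ n : ℕ in atTop, ∀ F : (Fin n → Bool) → Bool,
      (∀ m : ℕ, 1 ≤ m → tailWeight (fun x : Fin n → Bool => sgn (F x)) m ≤ τ m) →
        |∑ N ∈ Finset.range (2 ^ n), ((ArithmeticFunction.liouville N : ℤ) : ℝ) *
            sgn (F (fun i : Fin n => Nat.testBit N i))| ≤ ε * (2 : ℝ) ^ n := by
  intro ε hε
  obtain ⟨c, hc, hB⟩ := bourgain_liouville_walsh_holds
  -- parameters
  set R : ℕ := ⌈(3 : ℝ) / c⌉₊ with hRdef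
  have hR1 : 1 ≤ R := by
    have : (0 : ℝ) < 3 / c := by positivity
    exact Nat.one_le_iff_ne_zero.mpr (Nat.pos_iff_ne_zero.mp (Nat.ceil_pos.mpr this))
  have hRc : 3 ≤ (R : ℝ) * c := by
    have h1 : (3 : ℝ) / c ≤ R := Nat.le_ceil _
    have := mul_le_mul_of_nonneg_right h1 hc.le
    rwa [div_mul_cancel₀ _ hc.ne'] at this
  filter_upwards [hB, eventually_params hR1 hε hτ] with n hBn hpar F hF
  obtain ⟨hRk, hηk, hτk⟩ := hpar
  set k : ℕ := ⌊((n : ℝ)) ^ ((1 : ℝ) / R)⌋₊ with hkdef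
  -- pass to the cube
  rw [MoebiusWalsh.sum_range_two_pow_eq_sum_cube
    (fun N => ((ArithmeticFunction.liouville N : ℤ) : ℝ) * sgn (F (fun i : Fin n => Nat.testBit N i)))]
  simp only [MoebiusWalsh.ofFn_testBit_bitsToNat]
  set f : (Fin n → Bool) → ℝ := fun y => sgn (F y) with hfdef
  set G : (Fin n → Bool) → ℝ := fun y =>
    ((ArithmeticFunction.liouville (bitsToNat (List.ofFn y)) : ℤ) : ℝ) with hGdef
  have hG : ∀ y, |G y| ≤ 1 := fun y =>
    Literature.NumberTheory.LFunctions.LiouvilleSum.abs_liouville_le_one _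
  have hf : ∀ y, |f y| ≤ 1 := fun y => by
    simp only [hfdef]; unfold sgn; split_ifs <;> simp
  -- Bourgain's bound on the cube, for every character
  set B : ℝ := (2 : ℝ) ^ ((n : ℝ) - (n : ℝ) ^ c) with hBdef
  have hWalsh : ∀ A : Finset (Fin n), |∑ y, G y * walsh A y| ≤ B := by
    intro A
    have h := hBn A
    rw [MoebiusWalsh.sum_range_two_pow_eq_sum_cube
      (fun N => (ArithmeticFunction.liouville N : ℝ) * walsh A (fun j : Fin n => N.testBit j))] at h
    simp only [MoebiusWalsh.ofFn_testBit_bitsToNat] at h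
    exact h
  have h0 : |∑ y, G y| ≤ B := by simpa using hWalsh ∅
  have hB0 : 0 ≤ B := by positivity
  have hcore := GreenAC0.core_bound (k := k) f G hf hG (E₀ := B) (E₁ := B)
    (τ := τ (k + 1)) hB0 h0 (fun S _ _ => hWalsh S) (hF (k + 1) (by omega))
  change |∑ y, G y * f y| ≤ ε * 2 ^ n
  refine hcore.trans ?_
  -- the three cost terms
  have hkn : k ^ R ≤ n := LtfCore.floor_rpow_pow_le hR1 n
  have hnk : n < (k + 1) ^ R := LtfCore.lt_floor_rpow_succ_pow hR1 n
  have hlow : ((n : ℝ) + 1) ^ k * B ≤ ε / 3 * 2 ^ n := LtfCore.low_term_le hc hRc hkn hnk hRk hηk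
  have hE0 : B ≤ ε / 3 * 2 ^ n := by
    refine le_trans ?_ hlow
    refine le_mul_of_one_le_left hB0 ?_
    exact one_le_pow₀ (by linarith [(Nat.cast_nonneg n : (0 : ℝ) ≤ n)])
  have hε3 : 0 < ε / 3 := by positivity
  have hsqrt : Real.sqrt (τ (k + 1)) ≤ ε / 3 := by
    rw [← Real.sqrt_sq hε3.le]; exact Real.sqrt_le_sqrt hτk
  have htail : (2 : ℝ) ^ n * Real.sqrt (τ (k + 1)) ≤ ε / 3 * 2 ^ n := by
    rw [mul_comm]
    exact mul_le_mul_of_nonneg_right hsqrt (by positivity)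
  linarith

/-- **Corollary (uniformly noise-stable classes).** If a class `𝓕` of Boolean functions (one set
for each input length) has a uniform Fourier-tail bound `W^{≥ m}[sgn ∘ F] ≤ τ(m)` (`m ≥ 1`, `F ∈ 𝓕 n`)
with `τ(m) → 0`, then `λ` is asymptotically orthogonal to `𝓕`: for every `ε > 0`, eventually in `n`,
`|Σ_{N<2ⁿ} λ(N) sgn F(bits N)| ≤ ε 2ⁿ` for all `F ∈ 𝓕 n`. -/
theorem liouville_orthogonal_of_uniform_tail (𝓕 : ∀ n : ℕ, Set ((Fin n → Bool) → Bool))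
    (τ : ℕ → ℝ) (hτ : Tendsto τ atTop (𝓝 0))
    (h𝓕 : ∀ n, ∀ F ∈ 𝓕 n, ∀ m : ℕ, 1 ≤ m → tailWeight (fun x : Fin n → Bool => sgn (F x)) m ≤ τ m) :
    ∀ ε : ℝ, 0 < ε → ∀ᶠ n : ℕ in atTop, ∀ F ∈ 𝓕 n,
      |∑ N ∈ Finset.range (2 ^ n), ((ArithmeticFunction.liouville N : ℤ) : ℝ) *
          sgn (F (fun i : Fin n => Nat.testBit N i))| ≤ ε * (2 : ℝ) ^ n := by
  intro ε hε
  filter_upwards [liouville_orthogonal_of_tailWeight τ hτ ε hε] with n hn F hF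
  exact hn F (h𝓕 n F hF)

/-- **Registered stub `stub_spectral`** (line `Sketch`, skeleton v4): the spectral criterion,
verbatim `liouville_orthogonal_of_tailWeight`. -/
theorem stub_spectral (τ : ℕ → ℝ) (hτ : Tendsto τ atTop (𝓝 0)) : ∀ ε : ℝ, 0 < ε → ∀ᶠ n : ℕ in atTop, ∀ F : (Fin n → Bool) → Bool, (∀ m : ℕ, 1 ≤ m → tailWeight (fun x : Fin n → Bool => sgn (F x)) m ≤ τ m) → |∑ N ∈ Finset.range (2 ^ n), ((ArithmeticFunction.liouville N : ℤ) : ℝ) * sgn (F (fun i : Fin n => Nat.testBit N i))| ≤ ε * (2 : ℝ) ^ n :=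
  liouville_orthogonal_of_tailWeight τ hτ

end Summit.QuantumAdvantage.QuantumAdvantage.Theorems.LiouvilleOrthogonalTC0
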